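import Literature.NumberTheory.GaloisRepresentations.IdeleClassFundamentalClassTower
import Literature.NumberTheory.GaloisRepresentations.IdeleClassModUnitsSClassModule
import Literature.Algebra.Homology.ClassModuleQuotientLayerTower
import HarnessLib

/-!
# Quotient layers of the idèle class tower (`C_E ↠ C_S(E) = C_E / U_{E,S}`): the classes of `Hⁿ⁺³` killed by `e`
# die in every layer `M ⊇ E` with `e ∣ [M:E]` (Harari Thm. 17.2 with Lemma 16.20 on `ℓ`-parts; Milne ADT I Lemma 1.9
# for the `P`-class formation `(G_S, C_S)`)

Topic `NumberTheory/GaloisRepresentations`; namespace `Literature.NumberTheory.GaloisRepresentations.IdeleCohomology`.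
THEOREMS ONLY (no definition, no named fact, no instance, no `sorry`; number fields in `Type`).  Sequel of
`IdeleClassFundamentalClassTower` (door-c6: THE canonical classes `u_{E/F}` with `Inf u_{E/F} = [M:E]·u_{M/F}`,
`classInf_fundamentalClassAll`, and the class-module structure `exists_isClassModule_H2π_eq_fundamentalClassAll`),
`IdeleClassModUnitsSClassModule` (`C_S(E) = classModUnitsRep F E S` satisfies I. `H¹(U, C_S(E)) = 0`, II.
`#H²(U, C_S(E)) = #U`, and `Hⁿ(·, C_E) ≅ Hⁿ(·, C_S(E))` for `n ≥ 1`, `S ⊇ ram`) and the engine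
`Algebra/Homology/ClassModuleQuotientLayerTower` (seat w4 g19: the tower law and Milne's Lemma 1.9 on `ℓ`-parts pass
to compatible quotient layers).

THE POINT.  Harari's `S`-idèle class formation `(G_S, C_S = lim→ C_S(E))` (Def. 15.38, Thm. 17.2) is only a
`P`-class formation (Remark 16.24 (b), Remark 17.1): inside `K_S` one does not find, above a layer `E`, layers `M` with
`[E:F] ∣ [M:E]` in general — only `p`-power indices for the primes `p` with `p^∞ ∣ #G_S` (cyclotomic layers, `S ⊇ S_p`).
The hypothesis «`Hʳ(U, C̄_S)` has no `p`-torsion for `r ≥ 3`» of the `p`-primary duality theorem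
(`TateDualityHypothesesAt p`, field `ext_triv_eq_zero_of_nsmul_eq_zero`; Harari §16.4 «Theorem 16.21 extends to
`P`-class formations provided one restricts everywhere to `ℓ`-primary components») is therefore the colimit of
the following LAYER STATEMENT, proved here for ANY quotient layers `q_E : C_E ↠ A_E`, `q_M : C_M ↠ A_M` of the idèle
class tower `F ⊆ E ⊆ M` (both Galois over `F`) linked by a `Gal(M/F)`-map `j : A_E → A_M` over the base change
`C_E → C_M` (`classInflHom F E M`), provided `A_E` satisfies the class-module axioms numerically and `H²(q_E)` is
injective: **every `y ∈ Hⁿ⁺³(Gal(E/F), A_E)` with `e · y = 0`, `e ∣ [M:E]`, has `Inf_j y = 0` in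
`Hⁿ⁺³(Gal(M/F), A_M)`**, and the same for the relative layers `H_E ≤ Gal(E/F)`, `H_M ≤ Gal(M/F)` (`res(H_M) ≤ H_E`)
cut out by an open subgroup (Harari Lemma 16.20 at `U`).  For `A = C_S(·)` (`classModUnitsRep`, `S ⊇` the places
ramified in `E/F`) the three numerical hypotheses are the tree's `isZero_H1_res_classModUnits`,
`natCard_H2_res_classModUnits`, `isIso_groupCohomology_map_classModUnits` (§2); the linking map `j` for `C_S(·)` is
left as a parameter here (any `Gal(M/F)`-map over `classInflHom`; its construction from `cokernel.desc` and
`classBaseChange_mem_range_unitsOffToClass` is a definition, filed separately).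

Cell `bsd-eis`, background lane «PT-Ш-S-TC» of crux `GoodLatticeBDPValue` (stmt-BirchSwinnertonDyer-19032), brick D2-TN
(T2b), seat bsd-line-x1-p1-w4 g19.  HONEST FRAMING: finite-layer cohomology of idèle class groups; no duality theorem,
no case of Poitou–Tate and no case of BSD is proved here.

## References
* D. Harari, *Galois Cohomology and Class Field Theory* (2020), Def. 15.38, Prop. 15.40, §16.3 Lemma 16.20, §16.4
  Remark 16.24 (b), §17.1 Remark 17.1 and Thm. 17.2. [Harari2020]
* J. S. Milne, *Arithmetic Duality Theorems* (2nd ed. 2006), I §1 Lemma 1.9, I §4 (the `P`-class formation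
  `(G_S, C_S)`). [MilneADT2006]
* J.-P. Serre, *Local Fields*, GTM 67 (1979), XI §3 (`Inf(u_{F/E}) = [F':F]·u_{F'/E}`). [SerreLocalFields1979]
-/

noncomputable section

open NumberField IsDedekindDomain CategoryTheory CategoryTheory.Limits groupCohomology
open Literature.NumberTheory.Automorphic Literature.Algebra.Homology

namespace Literature.NumberTheory.GaloisRepresentations

namespace IdeleCohomology

/-! ## §1. Any quotient layers of the idèle class tower -/

section QuotientLayers

variable {F E M : Type} [Field F] [NumberField F] [Field E] [NumberField E] [Field M] [NumberField M]
  [Algebra F E] [IsGalois F E] [Algebra F M] [IsGalois F M] [Algebra E M] [IsScalarTower F E M]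
  {A_E : Rep ℤ (E ≃ₐ[F] E)} {A_M : Rep ℤ (M ≃ₐ[F] M)}
  (qE : IdeleClassGroup.galoisRep F E ⟶ A_E) (qM : IdeleClassGroup.galoisRep F M ⟶ A_M)
  (j : Rep.res (AlgEquiv.restrictNormalHom E) A_E ⟶ A_M)
  (hsq : ∀ c : (IdeleClassGroup.galoisRep F E).V, j.hom (qE.hom c) = qM.hom ((classInflHom F E M).hom c))

/-- **The tower law for THE canonical fundamental classes in the engine's currency**: for cocycles `φ_E`, `φ_M`
representing `u_{E/F}`, `u_{M/F}`, `Inf [φ_E] = [M:E] • [φ_M]` along `classInflHom F E M` (Serre XI §3; the tree's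
`classInf_fundamentalClassAll`). [cite: SerreLocalFields1979, Ch. XI §3] [cite: Harari2020, §17.1 Thm. 17.2] -/
theorem map_classInflHom_H2π_eq_finrank_nsmul {φE : cocycles₂ (IdeleClassGroup.galoisRep F E)}
    {φM : cocycles₂ (IdeleClassGroup.galoisRep F M)}
    (hφE : H2π (IdeleClassGroup.galoisRep F E) φE = fundamentalClassAll F E)
    (hφM : H2π (IdeleClassGroup.galoisRep F M) φM = fundamentalClassAll F M) :
    map (AlgEquiv.restrictNormalHom E) (classInflHom F E M) 2 (H2π (IdeleClassGroup.galoisRep F E) φE) =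
      Module.finrank E M • H2π (IdeleClassGroup.galoisRep F M) φM := by
  rw [hφE, hφM]
  exact classInf_fundamentalClassAll F E M

include hsq in
/-- **Quotient layers of the idèle class tower: classes killed by `e ∣ [M:E]` die in `M`.**  Let `q_E : C_E → A_E`,
`q_M : C_M → A_M` be `Gal`-equivariant maps and `j : Res A_E → A_M` a `Gal(M/F)`-map with `j ∘ q_E = q_M ∘ (C_E → C_M)`.
If I. `H¹(U, A_E) = 0` and II. `#H²(U, A_E) = #U` for every `U ≤ Gal(E/F)` and `H²(q_E)` is injective (so
`(A_E, H²(q_E) u_{E/F})` is a class module), then every `y ∈ Hⁿ⁺³(Gal(E/F), A_E)` with `e · y = 0` and `e ∣ [M:E]`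
satisfies `Inf_j y = 0` in `Hⁿ⁺³(Gal(M/F), A_M)` (THE classes `Inf u_{E/F} = [M:E]·u_{M/F}` transferred to the quotients
and the `ℓ`-part Tate–Nakayama engine; Harari Lemma 16.20 / Milne I Lemma 1.9 for a `P`-class formation).
[cite: Harari2020, §16.3 Lemma 16.20, Remark 16.24 (b), §17.1 Thm. 17.2] [cite: MilneADT2006, Ch. I, Lemma 1.9] -/
theorem map_quotientLayer_eq_zero_of_nsmul_eq_zero_of_dvd_finrank
    (h1 : ∀ U : Subgroup (E ≃ₐ[F] E), IsZero (groupCohomology (Rep.res U.subtype A_E) 1))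
    (h2 : ∀ U : Subgroup (E ≃ₐ[F] E), Nat.card (groupCohomology (Rep.res U.subtype A_E) 2) = Nat.card U)
    (hinj : Function.Injective ((groupCohomology.functor ℤ (E ≃ₐ[F] E) 2).map qE))
    {e : ℕ} (he : e ∣ Module.finrank E M) (n : ℕ) (y : groupCohomology A_E (n + 3)) (hy : e • y = 0) :
    map (AlgEquiv.restrictNormalHom E) j (n + 3) y = 0 := by
  letI : Fintype (E ≃ₐ[F] E) := Fintype.ofFinite _
  obtain ⟨φE, hCE, hφE⟩ := exists_isClassModule_H2π_eq_fundamentalClassAll F E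
  obtain ⟨φM, -, hφM⟩ := exists_isClassModule_H2π_eq_fundamentalClassAll F M
  exact (hCE.quotientLayer_of_card_mapCocycles₂ (A₂ := A_E) qE h1 h2 hinj).map_quotientLayer_eq_zero_of_nsmul_eq_zero
    (AlgEquiv.restrictNormalHom E) (classInflHom F E M) qE qM j hsq
    (H2π_comp_map_apply (A := IdeleClassGroup.galoisRep F E) (MonoidHom.id (E ≃ₐ[F] E)) qE φE).symm φM
    (map_classInflHom_H2π_eq_finrank_nsmul hφE hφM) he n y hy

include hsq in
/-- `addOrderOf`-form: a class of `Hⁿ⁺³(Gal(E/F), A_E)` whose order divides `[M:E]` dies in `M`.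
[cite: Harari2020, §16.3 Lemma 16.20] [cite: MilneADT2006, Ch. I, Lemma 1.9] -/
theorem map_quotientLayer_eq_zero_of_addOrderOf_dvd_finrank
    (h1 : ∀ U : Subgroup (E ≃ₐ[F] E), IsZero (groupCohomology (Rep.res U.subtype A_E) 1))
    (h2 : ∀ U : Subgroup (E ≃ₐ[F] E), Nat.card (groupCohomology (Rep.res U.subtype A_E) 2) = Nat.card U)
    (hinj : Function.Injective ((groupCohomology.functor ℤ (E ≃ₐ[F] E) 2).map qE))
    (n : ℕ) (y : groupCohomology A_E (n + 3)) (hy : addOrderOf y ∣ Module.finrank E M) :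
    map (AlgEquiv.restrictNormalHom E) j (n + 3) y = 0 :=
  map_quotientLayer_eq_zero_of_nsmul_eq_zero_of_dvd_finrank qE qM j hsq h1 h2 hinj hy n y
    (addOrderOf_nsmul_eq_zero y)

variable (H_M : Subgroup (M ≃ₐ[F] M)) (H_E : Subgroup (E ≃ₐ[F] E)) (π' : H_M →* H_E)
  (hπ' : ∀ h : H_M, ((π' h : H_E) : E ≃ₐ[F] E) = AlgEquiv.restrictNormalHom E (h : M ≃ₐ[F] M))
  (ι' : Rep.res π' (Rep.res H_E.subtype (IdeleClassGroup.galoisRep F E)) ⟶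
    Rep.res H_M.subtype (IdeleClassGroup.galoisRep F M))
  (hι' : ∀ c : (IdeleClassGroup.galoisRep F E).V, ι'.hom c = (classInflHom F E M).hom c)
  (j' : Rep.res π' (Rep.res H_E.subtype A_E) ⟶ Rep.res H_M.subtype A_M) (hj' : ∀ a : A_E.V, j'.hom a = j.hom a)

include hsq hπ' hι' hj' in
/-- **The relative layers** (`H_E ≤ Gal(E/F)`, `H_M ≤ Gal(M/F)` with `res(H_M) ≤ H_E`, restricted along any
`π' : H_M → H_E` lifting `res` and any `ι'`, `j'` equal to `classInflHom`, `j` on vectors): every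
`y ∈ Hⁿ⁺³(H_E, Res A_E)` with `e · y = 0`, `e ∣ [M:E]`, has `Inf_{j'} y = 0` in `Hⁿ⁺³(H_M, Res A_M)` — the transition
maps of the direct system `Hʳ(H_E, C_S(E))`, `E ⊂ K_S`, computing `Hʳ(U, C̄_S)` at an open subgroup `U`.
[cite: Harari2020, §16.3 Lemma 16.20, Remark 16.24 (b), §17.1 Thm. 17.2] [cite: MilneADT2006, Ch. I, Lemma 1.9] -/
theorem map_quotientLayer_res_eq_zero_of_nsmul_eq_zero_of_dvd_finrank
    (h1 : ∀ U : Subgroup (E ≃ₐ[F] E), IsZero (groupCohomology (Rep.res U.subtype A_E) 1))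
    (h2 : ∀ U : Subgroup (E ≃ₐ[F] E), Nat.card (groupCohomology (Rep.res U.subtype A_E) 2) = Nat.card U)
    (hinj : Function.Injective ((groupCohomology.functor ℤ (E ≃ₐ[F] E) 2).map qE))
    {e : ℕ} (he : e ∣ Module.finrank E M) (n : ℕ) (y : groupCohomology (Rep.res H_E.subtype A_E) (n + 3))
    (hy : e • y = 0) : map π' j' (n + 3) y = 0 := by
  letI : Fintype (E ≃ₐ[F] E) := Fintype.ofFinite _
  letI : Fintype H_E := Fintype.ofFinite _
  obtain ⟨φE, hCE, hφE⟩ := exists_isClassModule_H2π_eq_fundamentalClassAll F E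
  obtain ⟨φM, -, hφM⟩ := exists_isClassModule_H2π_eq_fundamentalClassAll F M
  exact (hCE.quotientLayer_of_card_mapCocycles₂ (A₂ := A_E) qE h1 h2 hinj).map_quotientLayer_res_eq_zero_of_nsmul_eq_zero
    (AlgEquiv.restrictNormalHom E) (classInflHom F E M) qE qM j hsq H_M H_E π' hπ' ι' hι' j' hj'
    (H2π_comp_map_apply (A := IdeleClassGroup.galoisRep F E) (MonoidHom.id (E ≃ₐ[F] E)) qE φE).symm φM
    (map_classInflHom_H2π_eq_finrank_nsmul hφE hφM) he n y hy

include hsq hπ' hι' hj' in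
/-- `addOrderOf`-form of the relative statement. [cite: Harari2020, §16.3 Lemma 16.20] [cite: MilneADT2006, Ch. I, Lemma 1.9] -/
theorem map_quotientLayer_res_eq_zero_of_addOrderOf_dvd_finrank
    (h1 : ∀ U : Subgroup (E ≃ₐ[F] E), IsZero (groupCohomology (Rep.res U.subtype A_E) 1))
    (h2 : ∀ U : Subgroup (E ≃ₐ[F] E), Nat.card (groupCohomology (Rep.res U.subtype A_E) 2) = Nat.card U)
    (hinj : Function.Injective ((groupCohomology.functor ℤ (E ≃ₐ[F] E) 2).map qE))
    (n : ℕ) (y : groupCohomology (Rep.res H_E.subtype A_E) (n + 3)) (hy : addOrderOf y ∣ Module.finrank E M) :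
    map π' j' (n + 3) y = 0 :=
  map_quotientLayer_res_eq_zero_of_nsmul_eq_zero_of_dvd_finrank qE qM j hsq H_M H_E π' hπ' ι' hι' j' hj' h1 h2
    hinj hy n y (addOrderOf_nsmul_eq_zero y)

end QuotientLayers

/-! ## §2. The `S`-idèle class layers `C_S(E) = C_E / U_{E,S}` -/

section ClassModUnits

variable {F E M : Type} [Field F] [NumberField F] [Field E] [NumberField E] [Field M] [NumberField M]
  [Algebra F E] [IsGalois F E] [Algebra F M] [IsGalois F M] [Algebra E M] [IsScalarTower F E M]
  (S : Finset (HeightOneSpectrum (𝓞 F)))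

/-- **`H²(Gal(E/F), C_E) → H²(Gal(E/F), C_S(E))` is injective** for `S ⊇` the places ramified in `E` (it is an
isomorphism: `U_{E,S}` is cohomologically trivial, Harari Prop. 15.40 / proof of Thm. 17.2; the tree's
`isIso_groupCohomology_map_classModUnits` in the `groupCohomology.map` spelling). [cite: Harari2020, §17.1 Thm. 17.2 (proof)] -/
theorem map_cokernel_π_unitsOffToClass_two_injective
    (hS : ∀ v : HeightOneSpectrum (𝓞 F), v ∉ S → Algebra.IsUnramifiedIn (𝓞 E) v.asIdeal) :
    Function.Injective ((groupCohomology.functor ℤ (E ≃ₐ[F] E) 2).map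
      (cokernel.π (unitsOffToClass (F := F) (E := E) S) :
        IdeleClassGroup.galoisRep F E ⟶ classModUnitsRep F E S)) := by
  haveI := isIso_groupCohomology_map_classModUnits (F := F) (E := E) S hS 2
  exact (ConcreteCategory.bijective_of_isIso ((groupCohomology.functor ℤ (E ≃ₐ[F] E) 2).map
    (cokernel.π (unitsOffToClass (F := F) (E := E) S)))).1

/-- **`C_S(E)` is a class module with THE class**: the image of the canonical fundamental class `u_{E/F}` under
`C_E ↠ C_S(E)` is a fundamental class of `(Gal(E/F), C_S(E))` — the layers of Harari's `P`-class formation `(G_S, C_S)`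
with their canonical classes (`S ⊇` the places ramified in `E`).
[cite: Harari2020, §17.1 Thm. 17.2] [cite: Neukirch2013, Part I §7 Thm. (7.3)] -/
theorem isClassModule_classModUnits_of_H2π_eq
    (hS : ∀ v : HeightOneSpectrum (𝓞 F), v ∉ S → Algebra.IsUnramifiedIn (𝓞 E) v.asIdeal)
    {ψ : cocycles₂ (classModUnitsRep F E S)}
    (hψ : H2π (classModUnitsRep F E S) ψ =
      (groupCohomology.functor ℤ (E ≃ₐ[F] E) 2).map
        (cokernel.π (unitsOffToClass (F := F) (E := E) S) : IdeleClassGroup.galoisRep F E ⟶ classModUnitsRep F E S)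
        (fundamentalClassAll F E)) :
    IsClassModule (classModUnitsRep F E S) ψ := by
  letI : Fintype (E ≃ₐ[F] E) := Fintype.ofFinite _
  obtain ⟨φ, hC, hφ⟩ := exists_isClassModule_H2π_eq_fundamentalClassAll F E
  exact hC.quotientLayer_of_card (A₂ := classModUnitsRep F E S)
    (cokernel.π (unitsOffToClass (F := F) (E := E) S))
    (fun U => isZero_H1_res_classModUnits S hS U) (fun U => natCard_H2_res_classModUnits S hS U)
    (map_cokernel_π_unitsOffToClass_two_injective S hS) (by rw [hψ, hφ]; rfl)

variable (j : Rep.res (AlgEquiv.restrictNormalHom E) (classModUnitsRep F E S) ⟶ classModUnitsRep F M S)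
  (hsq : ∀ c : (IdeleClassGroup.galoisRep F E).V,
    j.hom ((cokernel.π (unitsOffToClass (F := F) (E := E) S)).hom c) =
      (cokernel.π (unitsOffToClass (F := F) (E := M) S)).hom ((classInflHom F E M).hom c))

include hsq in
/-- **The `S`-idèle class tower: classes of `Hⁿ⁺³(Gal(E/F), C_S(E))` killed by `e ∣ [M:E]` die in
`Hⁿ⁺³(Gal(M/F), C_S(M))`** along any `Gal(M/F)`-map `j : C_S(E) → C_S(M)` over the base change `C_E → C_M`
(`S ⊇` the places ramified in `E/F`).  With `e = p^a` and `M` a cyclotomic layer inside `K_S` this is the transition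
statement behind «`Hʳ(G_S, C_S)` has no `p`-torsion, `r ≥ 3`» (Harari Lemma 16.20 for the `P`-class formation of
Thm. 17.2). [cite: Harari2020, §16.3 Lemma 16.20, Remark 16.24 (b), §17.1 Thm. 17.2] [cite: MilneADT2006, Ch. I, Lemma 1.9] -/
theorem map_classModUnits_eq_zero_of_nsmul_eq_zero_of_dvd_finrank
    (hS : ∀ v : HeightOneSpectrum (𝓞 F), v ∉ S → Algebra.IsUnramifiedIn (𝓞 E) v.asIdeal)
    {e : ℕ} (he : e ∣ Module.finrank E M) (n : ℕ) (y : groupCohomology (classModUnitsRep F E S) (n + 3))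
    (hy : e • y = 0) : map (AlgEquiv.restrictNormalHom E) j (n + 3) y = 0 :=
  map_quotientLayer_eq_zero_of_nsmul_eq_zero_of_dvd_finrank (A_E := classModUnitsRep F E S)
    (A_M := classModUnitsRep F M S)
    (cokernel.π (unitsOffToClass (F := F) (E := E) S)) (cokernel.π (unitsOffToClass (F := F) (E := M) S)) j hsq
    (fun U => isZero_H1_res_classModUnits S hS U) (fun U => natCard_H2_res_classModUnits S hS U)
    (map_cokernel_π_unitsOffToClass_two_injective S hS) he n y hy

variable (H_M : Subgroup (M ≃ₐ[F] M)) (H_E : Subgroup (E ≃ₐ[F] E)) (π' : H_M →* H_E)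
  (hπ' : ∀ h : H_M, ((π' h : H_E) : E ≃ₐ[F] E) = AlgEquiv.restrictNormalHom E (h : M ≃ₐ[F] M))
  (ι' : Rep.res π' (Rep.res H_E.subtype (IdeleClassGroup.galoisRep F E)) ⟶
    Rep.res H_M.subtype (IdeleClassGroup.galoisRep F M))
  (hι' : ∀ c : (IdeleClassGroup.galoisRep F E).V, ι'.hom c = (classInflHom F E M).hom c)
  (j' : Rep.res π' (Rep.res H_E.subtype (classModUnitsRep F E S)) ⟶ Rep.res H_M.subtype (classModUnitsRep F M S))
  (hj' : ∀ a : (classModUnitsRep F E S).V, j'.hom a = j.hom a)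

include hsq hπ' hι' hj' in
/-- **The relative `S`-idèle class layers**: every `y ∈ Hⁿ⁺³(H_E, C_S(E))` with `e · y = 0`, `e ∣ [M:E]`, dies in
`Hⁿ⁺³(H_M, C_S(M))` (`H_E ≤ Gal(E/F)`, `H_M ≤ Gal(M/F)`, `res(H_M) ≤ H_E`; `S ⊇` the places ramified in `E/F`) — the
transitions of the direct system computing `Hʳ(U, C̄_S)` at an open subgroup `U ≤ G_S` (Harari Lemma 16.20 at `U`).
[cite: Harari2020, §16.3 Lemma 16.20, §17.1 Thm. 17.2] [cite: MilneADT2006, Ch. I, Lemma 1.9] -/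
theorem map_classModUnits_res_eq_zero_of_nsmul_eq_zero_of_dvd_finrank
    (hS : ∀ v : HeightOneSpectrum (𝓞 F), v ∉ S → Algebra.IsUnramifiedIn (𝓞 E) v.asIdeal)
    {e : ℕ} (he : e ∣ Module.finrank E M) (n : ℕ)
    (y : groupCohomology (Rep.res H_E.subtype (classModUnitsRep F E S)) (n + 3)) (hy : e • y = 0) :
    map π' j' (n + 3) y = 0 :=
  map_quotientLayer_res_eq_zero_of_nsmul_eq_zero_of_dvd_finrank (A_E := classModUnitsRep F E S)
    (A_M := classModUnitsRep F M S)
    (cokernel.π (unitsOffToClass (F := F) (E := E) S)) (cokernel.π (unitsOffToClass (F := F) (E := M) S)) j hsq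
    H_M H_E π' hπ' ι' hι' j' hj'
    (fun U => isZero_H1_res_classModUnits S hS U) (fun U => natCard_H2_res_classModUnits S hS U)
    (map_cokernel_π_unitsOffToClass_two_injective S hS) he n y hy

end ClassModUnits

end IdeleCohomology

end Literature.NumberTheory.GaloisRepresentations

end
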